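import Summits.CriticalPhenomena.SAWScalingLimit.Theorems.SAWLeftRightFKGLeftRightFKGStubLensDichotomyAux
import Summits.CriticalPhenomena.SAWScalingLimit.Theorems.SAWLeftRightFKGLeftRightFKGStubEndpointMonotoneAux2
import HarnessLib

/-!
# Stub `stub_lensDichotomy` of line `corner-localisation`

Crux `LeftRightFKG` (stmt-CriticalPhenomena-11232), vocabulary module
`Summits.CriticalPhenomena.SAWScalingLimit.Theorems.SAWLeftRightFKGLeftRightFKGDefs`; helper file
`…StubLensDichotomyAux` (Jordan curve theorem for lattice cycles, `wcross` bookkeeping).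

THE LENS DICHOTOMY: two distinct chords `γ₁ ≠ γ₂` of a prefix/suffix class `cls k π m σ` whose free
middles are vertex-disjoint are comparable in the left–right order `≼`.

Proof (`LensDichotomy.core`, at mesh `1`; general mesh by `MeshReduction`). Both chords are
longer than `k + m` (otherwise prefix and suffix overlap and determine the chord:
`length_eq_of_agree`, `eq_of_agree_of_length_le`); the middles `τᵢ = γᵢ[k, |γᵢ| - m]` are paths
from `p = π k` to `q = σ m` with disjoint interiors, not both the bare edge `p ∼ q`, so the
reduced lens `τ₁ · τ₂⁻¹` is a CYCLE of the lattice subgraph `Ω_1` (`IsPath.isCycle_append`), whose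
winding numbers take only the values `0` and `w₀` (`LensDichotomy.exists_wind_eq_of_isCycle`, the
Jordan curve theorem). About every face centre the full lens `γ₁ · γ₂⁻¹` has the same winding
number — prefix and suffix cancel in the crossing counts (`wcross_sub_wcross_eq_middles`) — so
`wcross γ₂ - wcross γ₁ ∈ {0, w₀}` facewise, and the order IS facewise dominance of crossing counts
(`Negative.wind_nonneg_iff_wcross`): `γ₁ ≼ γ₂` if `w₀ ≥ 0`, `γ₂ ≼ γ₁` if `w₀ < 0`.
-/

noncomputable section

open Set Complex Literature.Probability.LatticeModels Literature.Probability.RandomPlanarGeometry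
open Literature.Topology.PlaneTopology
open Summit.CriticalPhenomena.SAWScalingLimit.Theorems.LeftRightFKG.Negative

namespace Summit.CriticalPhenomena.SAWScalingLimit.Theorems.LeftRightFKG.CornerLoc

namespace LensDichotomy

variable {G : SimpleGraph (Site 2)}

/-! ## Two paths with a common prefix and suffix -/

/-- Two walks of the same length `≤ k + m + 1` agreeing on the first `k + 1` and the last `m + 1`
positions are equal. [folklore] -/
theorem eq_of_agree_of_length_le {a b : Site 2} {w₁ w₂ : G.Walk a b} {k m : ℕ}
    (hk : ∀ i ≤ k, w₁.getVert i = w₂.getVert i)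
    (hm : ∀ j ≤ m, w₁.reverse.getVert j = w₂.reverse.getVert j)
    (hl : w₁.length = w₂.length) (hn : w₁.length ≤ k + m + 1) : w₁ = w₂ := by
  refine SimpleGraph.Walk.ext_getVert_le_length hl fun i hi => ?_
  rcases le_or_gt i k with hik | hik
  · exact hk i hik
  · have h := hm (w₁.length - i) (by omega)
    rwa [SimpleGraph.Walk.getVert_reverse, SimpleGraph.Walk.getVert_reverse, ← hl,
      show w₁.length - (w₁.length - i) = i by omega] at h

/-- If two walks agree on the first `k + 1` and the last `m + 1` positions, the second is a path
and the first has length `≤ k + m`, then they have the same length. [folklore] -/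
theorem length_eq_of_agree {a b : Site 2} {w₁ w₂ : G.Walk a b} (hp : w₂.IsPath) {k m : ℕ}
    (hk : ∀ i ≤ k, w₁.getVert i = w₂.getVert i)
    (hm : ∀ j ≤ m, w₁.reverse.getVert j = w₂.reverse.getVert j)
    (hm₁ : m ≤ w₁.length) (hm₂ : m ≤ w₂.length) (hk₂ : k ≤ w₂.length)
    (hn : w₁.length ≤ k + m) : w₂.length = w₁.length := by
  have h := hm m le_rfl
  rw [SimpleGraph.Walk.getVert_reverse, SimpleGraph.Walk.getVert_reverse, hk _ (by omega)] at h
  have := hp.getVert_injOn (by simp only [Set.mem_setOf_eq]; omega)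
    (by simp only [Set.mem_setOf_eq]; omega) h
  omega

/-- The vertices of the middle `w[k, k + j]` of a walk. [folklore] -/
theorem exists_of_mem_support_middle {a b p q : Site 2} (w : G.Walk a b) {k j : ℕ}
    (hp : w.getVert k = p) (hq : (w.drop k).getVert j = q) {x : Site 2}
    (hx : x ∈ (((w.drop k).take j).copy hp hq).support) : ∃ t ≤ j, w.getVert (k + t) = x := by
  rw [SimpleGraph.Walk.support_copy, SimpleGraph.Walk.mem_support_iff_exists_getVert] at hx
  obtain ⟨t, ht, htl⟩ := hx
  rw [SimpleGraph.Walk.take_length] at htl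
  have htj : t ≤ j := htl.trans (min_le_left _ _)
  refine ⟨t, htj, ?_⟩
  rwa [SimpleGraph.Walk.take_getVert, SimpleGraph.Walk.drop_getVert, min_eq_right htj] at ht

/-- A vertex of the tail of the support of a path is not its initial vertex. [folklore] -/
theorem ne_of_mem_support_tail {u v x : Site 2} {τ : G.Walk u v} (hτ : τ.IsPath)
    (hx : x ∈ τ.support.tail) : x ≠ u := by
  rintro rfl
  have h := hτ.support_nodup
  rw [← τ.cons_tail_support, List.nodup_cons] at h
  exact h.1 hx

/-! ## The dichotomy at mesh `1` -/

/-- **THE LENS DICHOTOMY AT MESH `1`.** Two distinct chords `γ₁ ≠ γ₂` of a prefix/suffix class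
`cls k π m σ` of `Ω_1` whose free middles are vertex-disjoint are comparable in the left–right
order. Both chords are longer than `k + m` (otherwise prefix and suffix overlap and determine the
chord), the middles `τᵢ = γᵢ[k, |γᵢ| - m]` are paths from `p = π k` to `q = σ m` with disjoint
interiors, not both the bare edge `p ∼ q`, so the reduced lens `τ₁ · τ₂⁻¹` is a CYCLE of the
lattice subgraph `Ω_1`; by the Jordan curve theorem for lattice cycles
(`exists_wind_eq_of_isCycle`) its winding numbers take only the values `0` and `w₀`. About every
face centre the full lens `γ₁ · γ₂⁻¹` has the same winding number (prefix and suffix cancel in the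
crossing counts, `wcross_sub_wcross_eq_middles`), i.e. `wcross γ₂ - wcross γ₁ ∈ {0, w₀}` facewise,
and the order is facewise dominance of crossing counts (`wind_nonneg_iff_wcross`): `γ₁ ≼ γ₂` if
`w₀ ≥ 0`, `γ₂ ≼ γ₁` if `w₀ < 0`. [folklore] -/
theorem core {Ω : Set ℂ} {a b : Site 2} {k : ℕ} {π : ℕ → Site 2} {m : ℕ} {σ : ℕ → Site 2}
    {γ₁ γ₂ : SAW.DomainSAW Ω 1 a b} (hne : γ₁ ≠ γ₂) (h₁ : γ₁ ∈ cls k π m σ)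
    (h₂ : γ₂ ∈ cls k π m σ)
    (hdisj : ∀ i j : ℕ, k < i → i + m < γ₁.length → k < j → j + m < γ₂.length →
      γ₁.walk.getVert i ≠ γ₂.walk.getVert j) : lr γ₁ γ₂ ∨ lr γ₂ γ₁ := by
  have hG : ∀ x y, (discreteDomainGraph Ω 1).Adj x y → (zdGraph 2).Adj x y :=
    fun _ _ hxy => meshGraph_le_zdGraph _ _ (discreteDomainGraph_le_meshGraph _ _ hxy)
  -- lengths: `k, m < |γᵢ|`
  obtain ⟨hk₁, hm₁⟩ := EndpointMonotone.lt_length_of_ne h₁ h₂ hne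
  obtain ⟨hk₂, hm₂⟩ := EndpointMonotone.lt_length_of_ne h₂ h₁ hne.symm
  have hne' : γ₁.walk ≠ γ₂.walk := fun h => hne (EndpointMonotone.ext_walk h)
  obtain ⟨h₁a, h₁r⟩ : AgreeTo k π γ₁ ∧ AgreeToR m σ γ₁ := h₁
  obtain ⟨h₂a, h₂r⟩ : AgreeTo k π γ₂ ∧ AgreeToR m σ γ₂ := h₂
  have e₁ : γ₁.length = γ₁.walk.length := rfl
  have e₂ : γ₂.length = γ₂.walk.length := rfl
  -- agreement of the prefixes and of the suffixes; `p = π k`, `q = σ m`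
  have hk : ∀ i ≤ k, γ₁.walk.getVert i = γ₂.walk.getVert i :=
    fun i hi => (h₁a i hi).trans (h₂a i hi).symm
  have hm : ∀ j ≤ m, γ₁.walk.reverse.getVert j = γ₂.walk.reverse.getVert j :=
    fun j hj => (h₁r j hj).trans (h₂r j hj).symm
  have hp₁ : γ₁.walk.getVert k = π k := h₁a k le_rfl
  have hp₂ : γ₂.walk.getVert k = π k := h₂a k le_rfl
  have hσ₁ : γ₁.walk.reverse.getVert m = σ m := h₁r m le_rfl
  have hσ₂ : γ₂.walk.reverse.getVert m = σ m := h₂r m le_rfl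
  set w₁ := γ₁.walk
  set w₂ := γ₂.walk
  have hP₁ : w₁.IsPath := γ₁.isPath
  have hP₂ : w₂.IsPath := γ₂.isPath
  have hkm₁ : k + m < w₁.length := by
    by_contra h
    have hl := length_eq_of_agree hP₂ hk hm (by omega) (by omega) (by omega) (not_lt.1 h)
    exact hne' (eq_of_agree_of_length_le hk hm hl.symm (by omega))
  have hkm₂ : k + m < w₂.length := by
    by_contra h
    have hl := length_eq_of_agree hP₁ (fun i hi => (hk i hi).symm)
      (fun j hj => (hm j hj).symm) (by omega) (by omega) (by omega) (not_lt.1 h)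
    exact hne' (eq_of_agree_of_length_le hk hm hl (by omega))
  -- the middles `τᵢ = γᵢ[k, |γᵢ| - m]`, paths from `p = π k` to `q = σ m`
  have hq₁ : (w₁.drop k).getVert (w₁.length - m - k) = σ m := by
    rw [SimpleGraph.Walk.drop_getVert, ← hσ₁, SimpleGraph.Walk.getVert_reverse]
    congr 1
    omega
  have hq₂ : (w₂.drop k).getVert (w₂.length - m - k) = σ m := by
    rw [SimpleGraph.Walk.drop_getVert, ← hσ₂, SimpleGraph.Walk.getVert_reverse]
    congr 1
    omega
  set τ₁ : (discreteDomainGraph Ω 1).Walk (π k) (σ m) :=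
    ((w₁.drop k).take (w₁.length - m - k)).copy hp₁ hq₁ with hτ₁
  set τ₂ : (discreteDomainGraph Ω 1).Walk (π k) (σ m) :=
    ((w₂.drop k).take (w₂.length - m - k)).copy hp₂ hq₂ with hτ₂
  have hτ₁p : τ₁.IsPath := (SimpleGraph.Walk.isPath_copy _ _ _).2 ((hP₁.drop k).take _)
  have hτ₂p : τ₂.IsPath := (SimpleGraph.Walk.isPath_copy _ _ _).2 ((hP₂.drop k).take _)
  have hτ₁l : τ₁.length = w₁.length - m - k := by
    rw [hτ₁, SimpleGraph.Walk.length_copy, SimpleGraph.Walk.take_length,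
      SimpleGraph.Walk.drop_length]
    exact min_eq_left (by omega)
  have hτ₂l : τ₂.length = w₂.length - m - k := by
    rw [hτ₂, SimpleGraph.Walk.length_copy, SimpleGraph.Walk.take_length,
      SimpleGraph.Walk.drop_length]
    exact min_eq_left (by omega)
  -- the reduced lens `τ₁ · τ₂⁻¹` is a cycle
  have hdis : List.Disjoint τ₁.support.tail τ₂.reverse.support.tail := by
    intro x hx₁ hx₂
    have hxp : x ≠ π k := ne_of_mem_support_tail hτ₁p hx₁
    have hxq : x ≠ σ m := ne_of_mem_support_tail hτ₂p.reverse hx₂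
    obtain ⟨t, ht, htx⟩ := exists_of_mem_support_middle w₁ hp₁ hq₁ (List.mem_of_mem_tail hx₁)
    have hx₂' : x ∈ τ₂.support := by
      have h := List.mem_of_mem_tail hx₂
      rwa [SimpleGraph.Walk.support_reverse, List.mem_reverse] at h
    obtain ⟨s, hs, hsx⟩ := exists_of_mem_support_middle w₂ hp₂ hq₂ hx₂'
    have ht0 : t ≠ 0 := by
      rintro rfl
      exact hxp (by rw [← htx, add_zero]; exact hp₁)
    have htj : t ≠ w₁.length - m - k := fun ht' =>
      hxq (by rw [← htx, ht', ← SimpleGraph.Walk.drop_getVert]; exact hq₁)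
    have hs0 : s ≠ 0 := by
      rintro rfl
      exact hxp (by rw [← hsx, add_zero]; exact hp₂)
    have hsj : s ≠ w₂.length - m - k := fun hs' =>
      hxq (by rw [← hsx, hs', ← SimpleGraph.Walk.drop_getVert]; exact hq₂)
    exact hdisj (k + t) (k + s) (by omega) (by omega) (by omega) (by omega) (htx.trans hsx.symm)
  have hLc : (τ₁.append τ₂.reverse).IsCycle := by
    refine hτ₁p.isCycle_append hτ₂p.reverse hdis ?_
    by_contra h
    rw [not_or, not_lt, not_lt, SimpleGraph.Walk.length_reverse, hτ₁l, hτ₂l] at h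
    exact hne' (eq_of_agree_of_length_le hk hm (by omega) (by omega))
  -- Jordan: the winding numbers of the reduced lens take the two values `0`, `w₀`; about face
  -- centres the full lens has the same winding numbers
  obtain ⟨w₀, hw₀⟩ := exists_wind_eq_of_isCycle hG hLc
  have hW : ∀ M K : ℤ, wcross M K w₂ - wcross M K w₁ = 0 ∨ wcross M K w₂ - wcross M K w₁ = w₀ := by
    intro M K
    have h := hw₀ (probeL M K)
    have hmid := wcross_sub_wcross_eq_middles M K w₁ w₂ hk hm hkm₁.le hkm₂.le
    rw [StepMono.wind_loop_probeL hG, ← wcross_eq_darts, wcross_append, wcross_reverse, hτ₁, hτ₂,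
      wcross_copy, wcross_copy] at h
    omega
  -- the order is facewise dominance of crossing counts
  obtain ⟨X0, X1, Y0, Y1, hbox⟩ := StepMono.exists_box (w₁.support ++ w₂.support)
  have hb₁ : ∀ x ∈ w₁.support, (X0 ≤ x 0 ∧ x 0 ≤ X1) ∧ (Y0 ≤ x 1 ∧ x 1 ≤ Y1) :=
    fun x hx => hbox x (List.mem_append_left _ hx)
  have hb₂ : ∀ x ∈ w₂.support, (X0 ≤ x 0 ∧ x 0 ≤ X1) ∧ (Y0 ≤ x 1 ∧ x 1 ≤ Y1) :=
    fun x hx => hbox x (List.mem_append_right _ hx)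
  rcases le_or_gt 0 w₀ with hw | hw
  · left
    refine (wind_nonneg_iff_wcross hG w₁ w₂ hb₁ hb₂).2 fun M K _ _ _ _ => ?_
    rcases hW M K with h | h <;> omega
  · right
    refine (wind_nonneg_iff_wcross hG w₂ w₁ hb₂ hb₁).2 fun M K _ _ _ _ => ?_
    rcases hW M K with h | h <;> omega

end LensDichotomy

/-! ## The registered stub -/

/-- **THE LENS DICHOTOMY** (registered stub `stub_lensDichotomy` of line `corner-localisation`):
for every crux instance, two distinct chords of a prefix/suffix class `cls k π m σ` whose free
middles are vertex-disjoint are comparable in the left–right order `≼`. The mesh `δ > 0` is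
reduced to mesh `1` along the support-preserving order-isomorphism of `MeshReduction`
(`stub_meshReduction`), where `LensDichotomy.core` applies. [folklore] -/
theorem stub_lensDichotomy :
    ∀ (δ : ℝ) (c a b a' b' : Site 2) (C : (zdGraph 2).Walk c c), IsInst δ a b a' b' C →
      ∀ (k : ℕ) (π : ℕ → Site 2) (m : ℕ) (σ : ℕ → Site 2)
        (γ₁ γ₂ : SAW.DomainSAW (dom C δ) δ a b), γ₁ ≠ γ₂ → γ₁ ∈ cls k π m σ → γ₂ ∈ cls k π m σ →
        (∀ i j : ℕ, k < i → i + m < γ₁.length → k < j → j + m < γ₂.length →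
          γ₁.walk.getVert i ≠ γ₂.walk.getVert j) → lr γ₁ γ₂ ∨ lr γ₂ γ₁ := by
  intro δ c a b a' b' C hI k π m σ γ₁ γ₂ hne h₁ h₂ hdisj
  obtain ⟨hδ, -, -, -, -⟩ := hI
  obtain ⟨e, he, hlr⟩ := stub_meshReduction δ c a b C hδ
  have hget : ∀ (γ : SAW.DomainSAW (dom C δ) δ a b) (i : ℕ),
      (e γ).walk.getVert i = γ.walk.getVert i :=
    fun γ i => StepMono.getVert_eq_of_support_eq _ _ (he γ) i
  have hgetR : ∀ (γ : SAW.DomainSAW (dom C δ) δ a b) (i : ℕ),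
      (e γ).walk.reverse.getVert i = γ.walk.reverse.getVert i := fun γ i =>
    StepMono.getVert_eq_of_support_eq _ _
      (by rw [SimpleGraph.Walk.support_reverse, SimpleGraph.Walk.support_reverse, he γ]) i
  have hlen : ∀ γ : SAW.DomainSAW (dom C δ) δ a b, (e γ).length = γ.length := fun γ => by
    have h := congrArg List.length (he γ)
    rw [SimpleGraph.Walk.length_support, SimpleGraph.Walk.length_support] at h
    show (e γ).walk.length = γ.walk.length
    omega
  have hcls : ∀ γ : SAW.DomainSAW (dom C δ) δ a b, γ ∈ cls k π m σ → e γ ∈ cls k π m σ :=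
    fun γ hγ =>
      ⟨fun i hi => (hget γ i).trans (hγ.1 i hi), fun j hj => (hgetR γ j).trans (hγ.2 j hj)⟩
  have key := LensDichotomy.core (e.injective.ne hne) (hcls γ₁ h₁) (hcls γ₂ h₂)
    (fun i j hi him hj hjm => by
      rw [hget, hget]
      rw [hlen] at him hjm
      exact hdisj i j hi him hj hjm)
  rcases key with h | h
  · exact Or.inl ((hlr γ₁ γ₂).2 h)
  · exact Or.inr ((hlr γ₂ γ₁).2 h)

end Summit.CriticalPhenomena.SAWScalingLimit.Theorems.LeftRightFKG.CornerLoc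

end
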